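import Summits.RiemannHypothesis.RiemannHypothesis.Theses.WeilGroundState
import Summits.RiemannHypothesis.RiemannHypothesis.Theorems.WeilGroundStateGroundStatesConvergeToXiEvenWitness
import Summits.RiemannHypothesis.RiemannHypothesis.Theorems.WeilGroundStateGroundStatesConvergeToXiFrequentlySimpleEven
import Literature.NumberTheory.LFunctions.WeilGroundState
import Literature.NumberTheory.LFunctions.WeilWindowSimpleEven
import Literature.NumberTheory.LFunctions.WeilGroundStateRealZerosProofs
import HarnessLib

/-!
# RiemannHypothesis / WeilGroundState — parity drops out of the route: the crux plus an
EVENTUAL PARITY-FREE SPECTRAL GAP at the bottom proves RH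

Route `RiemannHypothesis/WeilGroundState`, crux item stmt-RiemannHypothesis-1527
(`GroundStatesConvergeToXi`), line `Sketch`, continuation lead c4 (helper file, `--supports`;
sharpening of the route's assembly for the planner).

The route assembles RH from crux #3 (`GroundStatesConvergeToXi`), crux #2
(`GroundStateSimpleEven`: at EVERY window the bottom is simple, isolated AND EVEN, i.e.
`WeilWindowSimpleEven a`) and Connes–van Suijlekom Thm 6.1.  Lead c3 weakened "every window" to
"infinitely many witness windows" (`riemannHypothesis_of_cruxWitness_frequently_windowSimpleEven`);
this file removes the PARITY clause as well, using the parity normal form of the crux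
(`exists_even_cruxWitness`, file `…EvenWitness`):

* `integral_mul_conj_eq_zero_of_odd_of_even` — `∫ g ū = 0` for `g` odd and `u` even.
* `weilWindowSimpleEven_of_gap_of_even` — **a parity-free variational gap in the direction of an
  EVEN function `u` is already `WeilWindowSimpleEven a`** (with `φ = u`): if
  `δ(‖g‖² − |⟨g,u⟩|²) ≤ Re Q(g) − ε(a)‖g‖²` for all window tests `g` (the form PROVED from
  `WeilWindowSimpleEven` for ground states by `ConnesVanSuijlekom.gap_inequality`), then odd
  normalised tests (`⟨g,u⟩ = 0` automatically) and even ones orthogonal to `u` have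
  `Re Q ≥ ε(a) + δ`.
* `riemannHypothesis_of_cruxWitness_of_eventually_gap`,
  `riemannHypothesis_of_groundStatesConvergeToXi_of_eventually_gap` — **crux #3 + "for all large
  windows `a`, every ground state `u` at `a` has a spectral gap `δ > 0` in its own direction"
  ⇒ RH.**  Proof: pass to an even witness (`exists_even_cruxWitness`); at its windows the gap
  hypothesis applied to the even ground state gives `WeilWindowSimpleEven (a'_k)` eventually, and
  c3's frequently-simple-even theorem (C–vS + Hurwitz) concludes.

So for the route, crux #2 may be replaced by the parity-free and eventual window property
`∀ᶠ a, ∀ u, IsWeilGroundState a u → ∃ δ > 0, GAP(u, δ)` (simplicity/isolation of the bottom);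
evenness of the bottom along the witness windows is then a CONSEQUENCE of crux #3
(`eventually_weilEvenGroundEnergy_eq_of_cruxWitness`).  RH-free; no new definitions.
-/

set_option linter.dupNamespace false

noncomputable section

open MeasureTheory Complex Filter Set
open scoped Real Topology ComplexConjugate

namespace Summit.RiemannHypothesis.RiemannHypothesis.Theorems.GroundStatesConvergeToXi

open Literature.NumberTheory.LFunctions

/-- `∫ g ū = 0` for `g` odd and `u` even (the integrand is odd; no integrability needed).
[folklore] -/
theorem integral_mul_conj_eq_zero_of_odd_of_even {g u : ℝ → ℂ} (hodd : ∀ t, g (-t) = -g t)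
    (heven : ∀ t, u (-t) = u t) : ∫ t, g t * conj (u t) = 0 := by
  have h1 : ∫ t, g t * conj (u t) = ∫ t, g (-t) * conj (u (-t)) :=
    (integral_neg_eq_self (fun t ↦ g t * conj (u t)) volume).symm
  have h2 : ∫ t, g (-t) * conj (u (-t)) = -∫ t, g t * conj (u t) := by
    rw [← integral_neg]
    congr 1 with t
    rw [hodd, heven, neg_mul]
  linear_combination (h1.trans h2) / 2

/-- **A parity-free variational gap in the direction of an even function is
`WeilWindowSimpleEven`.**  If `u` is even and `δ > 0` satisfies
`δ(∫‖g‖² − ‖∫ g ū‖²) ≤ Re Q(g) − ε(a)∫‖g‖²` for every test function `g` supported in `[-a, a]`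
(the gap inequality of Connes–van Suijlekom in the direction `u`), then `WeilWindowSimpleEven a`
holds with `φ = u` and the same `δ`: odd normalised window tests are orthogonal to `u`, and for
even ones the orthogonality `∫ ū g = 0` is the hypothesis of the clause. [folklore] -/
theorem weilWindowSimpleEven_of_gap_of_even {a δ : ℝ} {u : ℝ → ℂ} (heven : ∀ t, u (-t) = u t)
    (hδ : 0 < δ)
    (hgap : ∀ g : ℝ → ℂ, IsWeilTest g → tsupport g ⊆ Icc (-a) a →
      δ * ((∫ t, ‖g t‖ ^ 2) - ‖∫ t, g t * conj (u t)‖ ^ 2) ≤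
        (weilQuadratic g).re - weilGroundEnergy a * ∫ t, ‖g t‖ ^ 2) :
    WeilWindowSimpleEven a := by
  refine ⟨u, δ, hδ, fun g hg hgs hg1 hpar ↦ ?_⟩
  have h0 : ∫ t, g t * conj (u t) = 0 := by
    rcases hpar with hodd | ⟨-, horth⟩
    · exact integral_mul_conj_eq_zero_of_odd_of_even hodd heven
    · rw [← horth]
      congr 1 with t
      rw [mul_comm]
  have h := hgap g hg hgs
  rw [hg1, h0, norm_zero, mul_one] at h
  norm_num at h
  linarith

/-- **Crux witness + eventual parity-free gap ⇒ RH.**  Let `(a_k, u_k, c_k)` be a crux-shaped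
witness (`a_k → ∞`, ground states `u_k`, `c_k · weilMellin u_k → ξ` locally uniformly on the open
strip) and suppose that for all large windows `a` EVERY ground state `u` at `a` has a spectral gap
in its own direction: `∃ δ > 0, ∀ window tests g, δ(‖g‖² − |⟨g,u⟩|²) ≤ Re Q(g) − ε(a)‖g‖²`.
Then RH.  (Even witness by `exists_even_cruxWitness`; at its windows the gap hypothesis gives
`WeilWindowSimpleEven` by `weilWindowSimpleEven_of_gap_of_even`; then
`riemannHypothesis_of_cruxWitness_frequently_windowSimpleEven`.) [folklore] -/
theorem riemannHypothesis_of_cruxWitness_of_eventually_gap {a : ℕ → ℝ} {u : ℕ → ℝ → ℂ}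
    {c : ℕ → ℂ} (ha : Tendsto a atTop atTop) (hu : ∀ k, IsWeilGroundState (a k) (u k))
    (hlim : TendstoLocallyUniformlyOn (fun k s ↦ c k * weilMellin (u k) s) riemannXi atTop
      {s : ℂ | 0 < s.re ∧ s.re < 1})
    (hgap : ∀ᶠ a in atTop, ∀ u : ℝ → ℂ, IsWeilGroundState a u →
      ∃ δ : ℝ, 0 < δ ∧ ∀ g : ℝ → ℂ, IsWeilTest g → tsupport g ⊆ Icc (-a) a →
        δ * ((∫ t, ‖g t‖ ^ 2) - ‖∫ t, g t * conj (u t)‖ ^ 2) ≤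
          (weilQuadratic g).re - weilGroundEnergy a * ∫ t, ‖g t‖ ^ 2) :
    RiemannHypothesis := by
  obtain ⟨a', v, c', ha', hc', hv, hev, hlim'⟩ := exists_even_cruxWitness ha hu hlim
  have hW : ∀ᶠ k in atTop, WeilWindowSimpleEven (a' k) := by
    filter_upwards [ha'.eventually hgap] with k hk
    obtain ⟨δ, hδ, hgapk⟩ := hk (v k) (hv k)
    exact weilWindowSimpleEven_of_gap_of_even (hev k) hδ hgapk
  exact riemannHypothesis_of_cruxWitness_frequently_windowSimpleEven hv
    (Eventually.of_forall hc') hlim' hW.frequently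

/-- **Parity drops out of the route: crux #3 + an eventual parity-free spectral gap at the bottom
⇒ RH** (`GroundStatesConvergeToXi` form).  Compared with the route's assembly (crux #3 +
`GroundStateSimpleEven` at every window + C–vS), the parity clause is gone and "every window"
is "all large windows". [folklore] -/
theorem riemannHypothesis_of_groundStatesConvergeToXi_of_eventually_gap
    (hcrux : Summit.RiemannHypothesis.RiemannHypothesis.Theses.WeilGroundState.GroundStatesConvergeToXi)
    (hgap : ∀ᶠ a in atTop, ∀ u : ℝ → ℂ, IsWeilGroundState a u →
      ∃ δ : ℝ, 0 < δ ∧ ∀ g : ℝ → ℂ, IsWeilTest g → tsupport g ⊆ Icc (-a) a →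
        δ * ((∫ t, ‖g t‖ ^ 2) - ‖∫ t, g t * conj (u t)‖ ^ 2) ≤
          (weilQuadratic g).re - weilGroundEnergy a * ∫ t, ‖g t‖ ^ 2) :
    RiemannHypothesis := by
  obtain ⟨a, u, c, ha, hk, hlim⟩ := hcrux
  exact riemannHypothesis_of_cruxWitness_of_eventually_gap ha
    (fun k ↦ ⟨(hk k).2.2.1, (hk k).2.2.2⟩) hlim hgap

/-- Conversely the gap hypothesis is implied by the route's parity crux: `WeilWindowSimpleEven a`
gives every ground state at `a` a gap in its own direction (`ConnesVanSuijlekom.gap_inequality`),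
so `riemannHypothesis_of_groundStatesConvergeToXi_of_eventually_gap` is at least as strong as the
assembly with `∀ᶠ a, WeilWindowSimpleEven a`. [folklore] -/
theorem eventually_gap_of_eventually_windowSimpleEven
    (hW : ∀ᶠ a in atTop, WeilWindowSimpleEven a) :
    ∀ᶠ a in atTop, ∀ u : ℝ → ℂ, IsWeilGroundState a u →
      ∃ δ : ℝ, 0 < δ ∧ ∀ g : ℝ → ℂ, IsWeilTest g → tsupport g ⊆ Icc (-a) a →
        δ * ((∫ t, ‖g t‖ ^ 2) - ‖∫ t, g t * conj (u t)‖ ^ 2) ≤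
          (weilQuadratic g).re - weilGroundEnergy a * ∫ t, ‖g t‖ ^ 2 :=
  hW.mono fun _ ha _ hu ↦ ConnesVanSuijlekom.gap_inequality ha hu

end Summit.RiemannHypothesis.RiemannHypothesis.Theorems.GroundStatesConvergeToXi

end
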